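import Summits.BirchSwinnertonDyer.BirchSwinnertonDyer.Theorems.PrintCf2SplitBadTwoRestrictedSelmerBottomShaBridge
import Summits.BirchSwinnertonDyer.BirchSwinnertonDyer.Theorems.PrintCf2SplitBadTwoCMEigenDecomposition
import Literature.NumberTheory.EllipticCurves.SelmerPInftyIsogeny
import HarnessLib

/-!
# Crux `PrintCf2.SplitBadTwoRankOneOfFacts` (stmt-BirchSwinnertonDyer-20368), road α, stub S3c — the Ш-image of the summand's Selmer classes
# lies in the `𝔮`-EIGEN PART of `Ш(E_K/K)[p^∞]`: an endomorphism acting on `E[𝔮_r^∞]` «as `r`» acts on the image of `H¹(K, E[𝔮_r^∞])` «as `r`»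

Cell `bsd-print-cf2`, width seat `bsd-line-cf2-p1-w7` g2, file 9 of the bottom-value lane (… p665244 `…BottomShaBridge`, p665606
`…BottomValueOfFactors`); `--supports stmt-BirchSwinnertonDyer-20368` (helper, Theses-free). HONEST FRAMING: nothing here closes a crux or a stub;
BSD is not proved by any of this; no summit statement is proved by this seat. No definition, no named fact, no `sorry`, no kit. beyond-print: no.

WHY. (F2) of `rBV_of_three_factor_values` (p665606) asks `v₂ #((𝔖_v ⊓ L_M) ⧸ Q_M) = v₂ #Ш(W/ℚ)[2^∞]`; by p665244 the quotient is `#f(𝔖_v ⊓ L_M)` for the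
canonical `f : H¹(⊤, E[𝔮_r^∞]) → H¹(K, E)` with image in `Ш(E_K/K)`; the -w8 lineage counts `#Ш(E_K/K)[2^∞] = (#C)²` for the EIGEN subgroup
`C = {x : ∀ k N, 2^k x = 0 → N ≡ r (2^k) → φ_* x = N x}` of a CM endomorphism (`CMShaModule.card_sha_two_primary_eq_sq_of_lift`). Here: for ANY
`Γ_K`-equivariant `f₀ : E(K̄) → E(K̄)` acting on `E[𝔮_r^∞]` «as `r`» at every finite level (e.g. `π` itself, `eigen_of_endRing`), EVERY class in the
image of `f` satisfies that eigen-predicate for `galH1Map f₀` and is `p`-power torsion — `f(S) ⊆ C_r ∩ Ш[p^∞]`: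
* `exists_eigen_resH1Hom_primaryTorsionMap` — LEVEL `⊤`: for `c ∈ H¹(⊤, E[𝔮_r^∞])` and every `k` there is `N ≡ r (p^k)` with `(f₀)_*(ι_* c) = N • ι_* c`
  (a continuous cocycle on the compact `⊤` has values of bounded exponent `p^J`; take `N = appr(r, J + k)`);
* `exists_eigen_galH1PrimaryMap` — the same on `H¹(Γ_K, E[p^∞])` through the bijection `res_⊤` (p665244);
* **`galH1Map_eq_zsmul_of_mem_range_shaMap`** — for `x ∈ f(S)`: `p^k • x = 0`, `N ≡ r (p^k)` ⟹ `galH1Map f₀ x = N • x` (naturality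
  `primaryH1ToH1_galH1PrimaryMap`, -w2 g7 `CMPrimes.zsmul_eq_zsmul_of_pow_dvd_sub`); `exists_pow_smul_eq_zero_of_mem_range_shaMap`.
The converse inclusion (eigen part of `Ш ∩ im` ⊆ `f(𝔖_v ⊓ L_M)`, via the splitting of p662922 and `π_*`-stability of `Sel_{p^∞}`) is the last step of (F2).

References: A. Agboola, Compositio 143 (2007) §6 [Agboola2007]; K. Rubin, LNM 1716 (1999) §2 [Rubin1999]; J.-P. Serre, *Galois Cohomology* I.§2
[SerreGaloisCohomology1997].
-/

noncomputable section

open scoped Classical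

set_option linter.dupNamespace false
set_option autoImplicit false

open NumberField IsDedekindDomain Field WeierstrassCurve
open Literature.NumberTheory.EllipticCurves Literature.NumberTheory.EllipticCurves.GreenbergSelmer
open Literature.NumberTheory.EllipticCurves.Castella2018.AcSelmer
open Literature.NumberTheory.EllipticCurves.Agboola2007
open Literature.NumberTheory.EllipticCurves.ResKernel
open Literature.NumberTheory.GaloisRepresentations

universe u

namespace Summit.BirchSwinnertonDyer.BirchSwinnertonDyer.Theorems.PrintCf2.RestrictedSelmerPair

section Eigen

variable {K : Type u} [Field K] [NumberField K] (V : WeierstrassCurve K) [V.IsElliptic] (p : ℕ) [Fact p.Prime]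
  (π : V.endRing) (r : ℤ_[p])
  (f₀ : V.geomPoints →+ V.geomPoints) (hf₀ : ∀ (σ : absoluteGaloisGroup K) (P : V.geomPoints), f₀ (σ • P) = σ • f₀ P)
  (hfr : ∀ (k : ℕ) (N : ℤ) (x : V.geomPrimaryTorsion p), x ∈ V.endEigenPrimaryTorsion p π r → p ^ k • x = 0 →
    ((N : ℤ_[p]) - r) ∈ (Ideal.span {(p : ℤ_[p]) ^ k} : Ideal ℤ_[p]) → f₀ (x : V.geomPoints) = N • (x : V.geomPoints))

omit [NumberField K] [V.IsElliptic] in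
/-- **The endomorphism `π` itself acts on `E[𝔮_r^∞]` «as `r`»** (definition of `endEigenPrimaryTorsion`) and is `Γ_K`-equivariant (definition of
`End_K(E)`): the two hypotheses of this file hold for `f₀ = π`. [cite: Rubin1999, §2 and Prop. 5.4] -/
theorem eigen_of_endRing :
    (∀ (σ : absoluteGaloisGroup K) (P : V.geomPoints),
        (π : AddMonoid.End V.geomPoints) (σ • P) = σ • (π : AddMonoid.End V.geomPoints) P) ∧
      ∀ (k : ℕ) (N : ℤ) (x : V.geomPrimaryTorsion p), x ∈ V.endEigenPrimaryTorsion p π r → p ^ k • x = 0 →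
        ((N : ℤ_[p]) - r) ∈ (Ideal.span {(p : ℤ_[p]) ^ k} : Ideal ℤ_[p]) →
          (π : AddMonoid.End V.geomPoints) (x : V.geomPoints) = N • (x : V.geomPoints) :=
  ⟨(V.mem_equivariantSubring_iff (π : AddMonoid.End V.geomPoints)).1 (Subring.mem_inf.1 π.2).2, fun k N _ hx hk hN ↦ hx k N hk hN⟩

omit [V.IsElliptic] in
include hfr in
/-- **`(f₀)_*` acts on the image of `H¹(⊤, E[𝔮_r^∞])` in `H¹(⊤, E[p^∞])` «as `r`»**: for every class `c` and every `k` there is `N ≡ r (mod p^k)`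
with `(f₀)_*(ι_* c) = N • ι_* c` (a continuous cocycle on the compact group `⊤ = Γ_K` has finitely many values, all in `E[𝔮_r^∞]`, of exponent `p^J`;
take `N = appr(r, J + k)`). [cite: Rubin1999, §2] [cite: SerreGaloisCohomology1997, I.§2.2] -/
theorem exists_eigen_resH1Hom_primaryTorsionMap (c : subgroupH1 (⊤ : Subgroup (absoluteGaloisGroup K)) ↥(V.endEigenPrimaryTorsion p π r))
    (k : ℕ) :
    ∃ N : ℕ, (((N : ℤ) : ℤ_[p]) - r) ∈ (Ideal.span {(p : ℤ_[p]) ^ k} : Ideal ℤ_[p]) ∧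
      resH1Hom (ContinuousMonoidHom.id _) (primaryTorsionMap p f₀)
          (fun σ x ↦ by
            rw [Subgroup.smul_def, Subgroup.smul_def]
            exact primaryTorsionMap_smul p f₀ hf₀ _ x)
        (resH1Hom (ContinuousMonoidHom.id _) (V.endEigenPrimaryTorsion p π r).subtype (fun _ _ ↦ rfl) c) =
      N • resH1Hom (ContinuousMonoidHom.id _) (V.endEigenPrimaryTorsion p π r).subtype (fun _ _ ↦ rfl) c := by
  obtain ⟨φ, rfl⟩ := oneCocycleClass_surjective _ c
  haveI : CompactSpace (absoluteGaloisGroup K) := compactSpace_absoluteGaloisGroup K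
  haveI : CompactSpace (⊤ : Subgroup (absoluteGaloisGroup K)) :=
    isCompact_iff_compactSpace.mp (by rw [Subgroup.coe_top]; exact isCompact_univ)
  obtain ⟨J, hJ⟩ := exists_pow_smul_apply_eq_zero (p := p) φ.1 (fun g ↦ by
    obtain ⟨j, hj⟩ := (AddCommGroup.mem_primaryComponent).mp ((φ.1 g : V.endEigenPrimaryTorsion p π r) : V.geomPrimaryTorsion p).2
    refine ⟨j, Subtype.ext (Subtype.ext ?_)⟩
    rw [AddSubmonoidClass.coe_nsmul, AddSubmonoidClass.coe_nsmul, ZeroMemClass.coe_zero, ZeroMemClass.coe_zero]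
    exact hj)
  set N : ℕ := PadicInt.appr r (J + k) with hNdef
  have hN : (((N : ℤ) : ℤ_[p]) - r) ∈ (Ideal.span {(p : ℤ_[p]) ^ (J + k)} : Ideal ℤ_[p]) := by
    have h := PadicInt.appr_spec (J + k) r
    rw [← Ideal.neg_mem_iff, neg_sub] at h
    push_cast
    exact h
  have hNk : (((N : ℤ) : ℤ_[p]) - r) ∈ (Ideal.span {(p : ℤ_[p]) ^ k} : Ideal ℤ_[p]) :=
    Ideal.span_singleton_le_span_singleton.mpr (pow_dvd_pow _ (Nat.le_add_left k J)) hN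
  refine ⟨N, hNk, ?_⟩
  -- the pushed-forward cocycle is `N •` the included cocycle
  set ψ := contOneCocycles.pullback (ContinuousMonoidHom.id (⊤ : Subgroup (absoluteGaloisGroup K)))
      (resHomOfEquivariant (ContinuousMonoidHom.id _) (V.endEigenPrimaryTorsion p π r).subtype (fun _ _ ↦ rfl)) φ with hψ
  have hval : ∀ g, (primaryTorsionMap p f₀ (ψ.1 g) : V.geomPrimaryTorsion p) = (N : ℤ) • ψ.1 g := by
    intro g
    have hlev : p ^ (J + k) • ((φ.1 g : V.endEigenPrimaryTorsion p π r) : V.geomPrimaryTorsion p) = 0 := by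
      have h1 : p ^ (J + k) • (φ.1 g) = 0 := by rw [pow_add, mul_comm, mul_smul, hJ g, smul_zero]
      have h2 := congrArg (fun z : V.endEigenPrimaryTorsion p π r ↦ (z : V.geomPrimaryTorsion p)) h1
      simpa using h2
    have hπ := hfr (J + k) (N : ℤ) _ (φ.1 g).2 hlev hN
    apply Subtype.ext
    rw [coe_primaryTorsionMap_apply, AddSubgroupClass.coe_zsmul]
    exact hπ
  have hcoc : contOneCocycles.pullback (ContinuousMonoidHom.id (⊤ : Subgroup (absoluteGaloisGroup K)))
      (resHomOfEquivariant (ContinuousMonoidHom.id _) (primaryTorsionMap p f₀)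
        (fun σ x ↦ by
          rw [Subgroup.smul_def, Subgroup.smul_def]
          exact primaryTorsionMap_smul p f₀ hf₀ _ x)) ψ = (N : ℤ) • ψ := by
    apply Subtype.ext
    ext g
    change ((primaryTorsionMap p f₀ (ψ.1 g) : V.geomPrimaryTorsion p) : V.geomPoints) =
      ((((N : ℤ) • ψ).1 g : V.geomPrimaryTorsion p) : V.geomPoints)
    rw [hval g, Submodule.coe_smul, ContinuousMap.coe_smul, Pi.smul_apply]
  have hs := oneCocycleClass_smul (discreteTopRep (⊤ : Subgroup (absoluteGaloisGroup K)) (V.geomPrimaryTorsion p)) (N : ℤ) ψ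
  conv at hs => rhs; rw [Nat.cast_smul_eq_nsmul]
  rw [resH1Hom_oneCocycleClass, resH1Hom_oneCocycleClass, ← hψ, hcoc, hs]

omit [V.IsElliptic] in
include hfr in
/-- **The same on `H¹(Γ_K, E[p^∞])`**, transported along the bijection `res_⊤` (p665244 `resSubgroup_top_bijective`): for `y` with
`res_⊤ y = ι_* c`, `(f₀)_* y = N • y` with `N ≡ r (mod p^k)`. [cite: SerreGaloisCohomology1997, I.§2.4] -/
theorem exists_eigen_galH1PrimaryMap (c : subgroupH1 (⊤ : Subgroup (absoluteGaloisGroup K)) ↥(V.endEigenPrimaryTorsion p π r))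
    (y : galH1Primary V p)
    (hy : resSubgroup ⊤ (V.geomPrimaryTorsion p) y =
      resH1Hom (ContinuousMonoidHom.id _) (V.endEigenPrimaryTorsion p π r).subtype (fun _ _ ↦ rfl) c)
    (k : ℕ) :
    ∃ N : ℕ, (((N : ℤ) : ℤ_[p]) - r) ∈ (Ideal.span {(p : ℤ_[p]) ^ k} : Ideal ℤ_[p]) ∧
      galH1PrimaryMap p f₀ hf₀ y = N • y := by
  obtain ⟨N, hN, heq⟩ := exists_eigen_resH1Hom_primaryTorsionMap V p π r f₀ hf₀ hfr c k
  refine ⟨N, hN, resSubgroup_injective_of_forall_mem ⊤ (V.geomPrimaryTorsion p) Subgroup.mem_top ?_⟩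
  have key := ResKernel.resH1Hom_comp_resSubgroup (ContinuousMonoidHom.id (absoluteGaloisGroup K))
    (primaryTorsionMap p f₀) (primaryTorsionMap_smul p f₀ hf₀) ⊤ ⊤ (ContinuousMonoidHom.id _) (fun _ ↦ rfl)
    (fun σ x ↦ by
      rw [Subgroup.smul_def, Subgroup.smul_def]
      exact primaryTorsionMap_smul p f₀ hf₀ _ x)
  have h2 := congrArg (fun f ↦ f y) key
  simp only [AddMonoidHom.comp_apply] at h2
  change resSubgroup ⊤ (V.geomPrimaryTorsion p)
      (resH1Hom (ContinuousMonoidHom.id (absoluteGaloisGroup K)) (primaryTorsionMap p f₀) (primaryTorsionMap_smul p f₀ hf₀) y) = _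
  rw [← h2, hy, heq, map_nsmul, hy]

variable (S : AddSubgroup (subgroupH1 (⊤ : Subgroup (absoluteGaloisGroup K)) ↥(V.endEigenPrimaryTorsion p π r)))

omit [V.IsElliptic] in
include hfr in
/-- **THE Ш-IMAGE OF THE SUMMAND'S CLASSES LIES IN THE `𝔮_r`-EIGEN PART.** For every `x` in the range of the canonical
`f_S = (H¹(K, E[p^∞]) → H¹(K, E)) ∘ res_⊤⁻¹ ∘ ι_*` (p665244) and every `k`, `N` with `p^k • x = 0`, `N ≡ r (mod p^k)`:
`galH1Map f₀ x = N • x` — the membership predicate of the eigen subgroup `C` of -w8's `CMShaModule.card_sha_two_primary_eq_sq_of_lift`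
(for `f₀` in the role of the CM isogeny). [cite: Rubin1999, §2] [cite: Agboola2007, §6 (Ш(K)(𝔭*) is the 𝔭*-part)] -/
theorem galH1Map_eq_zsmul_of_mem_range_shaMap {x : V.galH1}
    (hx : x ∈ (((V.primaryH1ToH1 p).comp (AddEquiv.ofBijective (resSubgroup ⊤ (V.geomPrimaryTorsion p))
        (resSubgroup_top_bijective (V.geomPrimaryTorsion p))).symm.toAddMonoidHom).comp
      ((resH1Hom (ContinuousMonoidHom.id _) (V.endEigenPrimaryTorsion p π r).subtype (fun _ _ ↦ rfl)).comp S.subtype)).range)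
    (k : ℕ) (N : ℤ) (hk : p ^ k • x = 0) (hN : ((N : ℤ_[p]) - r) ∈ (Ideal.span {(p : ℤ_[p]) ^ k} : Ideal ℤ_[p])) :
    galH1Map f₀ hf₀ x = N • x := by
  set R := resSubgroup (⊤ : Subgroup (absoluteGaloisGroup K)) (V.geomPrimaryTorsion p) with hR
  set Re := AddEquiv.ofBijective R (resSubgroup_top_bijective (V.geomPrimaryTorsion p)) with hRe
  obtain ⟨c, rfl⟩ := hx
  simp only [AddMonoidHom.comp_apply, AddSubgroup.coe_subtype, AddEquiv.coe_toAddMonoidHom] at hk ⊢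
  set y := Re.symm (resH1Hom (ContinuousMonoidHom.id _) (V.endEigenPrimaryTorsion p π r).subtype (fun _ _ ↦ rfl)
    (c : subgroupH1 ⊤ ↥(V.endEigenPrimaryTorsion p π r))) with hydef
  have hy : R y = resH1Hom (ContinuousMonoidHom.id _) (V.endEigenPrimaryTorsion p π r).subtype (fun _ _ ↦ rfl)
      (c : subgroupH1 ⊤ ↥(V.endEigenPrimaryTorsion p π r)) := Re.apply_symm_apply _
  obtain ⟨N', hN', heig⟩ := exists_eigen_galH1PrimaryMap V p π r f₀ hf₀ hfr c y hy k
  have h1 : galH1Map f₀ hf₀ (V.primaryH1ToH1 p y) = (N' : ℤ) • V.primaryH1ToH1 p y := by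
    rw [← primaryH1ToH1_galH1PrimaryMap, heig, map_nsmul, natCast_zsmul]
  rw [h1]
  exact CMPrimes.zsmul_eq_zsmul_of_pow_dvd_sub hk (CMPrimes.pow_dvd_sub_of_sub_mem_span hN' hN)

omit [V.IsElliptic] [Fact p.Prime] in
/-- Every class of `H¹(Γ_K, E[p^∞])` is `p`-power torsion (compactness: a representative cocycle has finitely many values in `E[p^∞]`).
[cite: SerreGaloisCohomology1997, I.§2.2] -/
theorem exists_pow_smul_galH1Primary_eq_zero (y : galH1Primary V p) : ∃ J : ℕ, p ^ J • y = 0 := by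
  obtain ⟨φ, rfl⟩ := oneCocycleClass_surjective _ y
  haveI : CompactSpace (absoluteGaloisGroup K) := compactSpace_absoluteGaloisGroup K
  obtain ⟨J, hJ⟩ := exists_pow_smul_apply_eq_zero (p := p) φ.1 (fun g ↦ by
    obtain ⟨j, hj⟩ := (AddCommGroup.mem_primaryComponent).mp (φ.1 g).2
    exact ⟨j, Subtype.ext (by rw [AddSubmonoidClass.coe_nsmul, ZeroMemClass.coe_zero]; exact hj)⟩)
  exact ⟨J, nsmul_oneCocycleClass_eq_zero φ (p ^ J) hJ⟩

omit [V.IsElliptic] in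
/-- **The Ш-image of the summand's classes is `p`-power torsion** (so it lies in `Ш(E_K/K)[p^∞]` once it lies in `Ш`, p665244
`range_shaMap_le_sha`). [cite: SerreGaloisCohomology1997, I.§2.2] -/
theorem exists_pow_smul_eq_zero_of_mem_range_shaMap {x : V.galH1}
    (hx : x ∈ (((V.primaryH1ToH1 p).comp (AddEquiv.ofBijective (resSubgroup ⊤ (V.geomPrimaryTorsion p))
        (resSubgroup_top_bijective (V.geomPrimaryTorsion p))).symm.toAddMonoidHom).comp
      ((resH1Hom (ContinuousMonoidHom.id _) (V.endEigenPrimaryTorsion p π r).subtype (fun _ _ ↦ rfl)).comp S.subtype)).range) :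
    ∃ J : ℕ, p ^ J • x = 0 := by
  obtain ⟨c, rfl⟩ := hx
  simp only [AddMonoidHom.comp_apply, AddSubgroup.coe_subtype, AddEquiv.coe_toAddMonoidHom]
  obtain ⟨J, hJ⟩ := exists_pow_smul_galH1Primary_eq_zero V p
    ((AddEquiv.ofBijective (resSubgroup ⊤ (V.geomPrimaryTorsion p)) (resSubgroup_top_bijective (V.geomPrimaryTorsion p))).symm
      (resH1Hom (ContinuousMonoidHom.id _) (V.endEigenPrimaryTorsion p π r).subtype (fun _ _ ↦ rfl)
        (c : subgroupH1 ⊤ ↥(V.endEigenPrimaryTorsion p π r))))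
  exact ⟨J, by rw [← map_nsmul, hJ, map_zero]⟩

end Eigen

end Summit.BirchSwinnertonDyer.BirchSwinnertonDyer.Theorems.PrintCf2.RestrictedSelmerPair

end
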